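import Mathlib
import HarnessLib
import Literature.Probability.MarkovChains.ReversibleSpectrumReal

/-!
# Lazy chains have non-negative spectrum, hence `γ⋆ = γ` (Levin–Peres–Wilmer Exercise 12.3)

HONEST FRAMING: exact (Metropolis-corrected) sampling algorithms for lattice gauge theory; figures
of merit are autocorrelation/cost numbers at stated couplings and volumes; no continuum-physics claim.

Conventions of `RelaxationTimeLowerBound.lean` (complex eigenpairs `∀ x, Σ_y P(x,y)f(y) = λf(x)`,
Lemma 12.1 (i) `norm_eigenvalue_le_one`), `RelaxationTime.lean` (`absSpectralGap P = γ⋆ = 1 − λ⋆`),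
`SpectralGapVariational.lean` (`spectralGap π P = γ = 1 − λ₂`), `SpectralRepresentation.lean`
(`specVal hA j = λ_j`) and `ReversibleSpectrumReal.lean` (`λ⋆ = max |λ_j|`, `λ₂ = max λ_j`, `γ⋆ ≤ γ`).
Source: D. A. Levin, Y. Peres (with E. L. Wilmer), *Markov Chains and Mixing Times*, 2nd ed., AMS 2017
[LevinPeres2017], §12.2 and Exercise 12.3 (with §1.3 for lazy chains).  Everything is PROVED
(0 named facts).  A chain is LAZY here when `P(x,x) ≥ ½` for every `x` (the lazy version
`(I + Q)/2` of any chain `Q` is of this form, and conversely such a `P` is `(I + Q)/2` with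
`Q = 2P − I` stochastic).

* `norm_two_mul_sub_one_le_one_of_lazy` — for a lazy row-stochastic `P`, every (complex) eigenvalue
  lies in the disc `|2λ − 1| ≤ 1` (Lemma 12.1 (i) for the stochastic matrix `Q = 2P − I`, whose
  eigenvalues are `2λ − 1`) [cite: LevinPeres2017, §12.2 Exercise 12.3 with §12.1 Lemma 12.1 (i)];
* `specVal_nonneg_of_lazy` — **all eigenvalues `λ_j` of a lazy reversible `P` are non-negative**
  ("Exercise 12.3: show that all eigenvalues of the lazy chain are non-negative")
  [cite: LevinPeres2017, Exercise 12.3];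
* **`LevinPeres2017_exercise_12_3`** — for a lazy, reversible, irreducible `P` (positive `π`,
  `|X| ≥ 2`): **`γ⋆ = γ`** ("Exercise 12.3 shows that if the chain is lazy, then `γ⋆ = γ`"), so
  `t_rel = 1/γ` [cite: LevinPeres2017, §12.2 (sentence after eq. (12.7)); Exercise 12.3].
-/

namespace Literature.Probability.MarkovChains

open Finset Matrix

variable {X : Type*} [Fintype X] [DecidableEq X]

/-- For a LAZY row-stochastic `P` (`P(x,x) ≥ ½`), `Q = 2P − I` is row-stochastic and has eigenvalue
`2λ − 1` on every eigenfunction of `P` with eigenvalue `λ`; hence `|2λ − 1| ≤ 1` by Lemma 12.1 (i).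
[cite: LevinPeres2017, §12.2 Exercise 12.3 with §12.1 Lemma 12.1 (i)] -/
theorem norm_two_mul_sub_one_le_one_of_lazy {P : X → X → ℝ} (hP : IsRowStochastic P)
    (hlazy : ∀ x, 1 / 2 ≤ P x x) {f : X → ℂ} {lam : ℂ}
    (hf : ∀ x, ∑ y, (P x y : ℂ) * f y = lam * f x) (hf0 : f ≠ 0) : ‖2 * lam - 1‖ ≤ 1 := by
  set Q : X → X → ℝ := fun x y => 2 * P x y - if x = y then 1 else 0 with hQ
  have hQst : IsRowStochastic Q := by
    refine ⟨fun x y => ?_, fun x => ?_⟩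
    · simp only [hQ]
      by_cases hxy : x = y
      · subst hxy; rw [if_pos rfl]; linarith [hlazy x]
      · rw [if_neg hxy, sub_zero]; exact mul_nonneg (by norm_num) (hP.1 x y)
    · simp only [hQ]
      rw [sum_sub_distrib, ← mul_sum, hP.2 x, sum_ite_eq univ x (fun _ => (1 : ℝ)), if_pos (mem_univ x)]
      norm_num
  have hQf : ∀ x, ∑ y, (Q x y : ℂ) * f y = (2 * lam - 1) * f x := by
    intro x
    simp only [hQ]
    push_cast
    have h1 : ∑ y, (2 * (P x y : ℂ) - if x = y then 1 else 0) * f y =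
        2 * ∑ y, (P x y : ℂ) * f y - ∑ y, (if x = y then (1 : ℂ) else 0) * f y := by
      rw [mul_sum, ← sum_sub_distrib]
      exact sum_congr rfl fun y _ => by ring
    have h2 : ∑ y, (if x = y then (1 : ℂ) else 0) * f y = f x := by
      simp_rw [ite_mul, one_mul, zero_mul]
      rw [sum_ite_eq univ x f, if_pos (mem_univ x)]
    have hcast : ∀ y, ((if x = y then (1 : ℝ) else 0 : ℝ) : ℂ) = if x = y then (1 : ℂ) else 0 :=
      fun y => by split_ifs <;> simp
    simp_rw [hcast]
    rw [h1, h2, hf x]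
    ring
  exact norm_eigenvalue_le_one hQst hQf hf0

section Spectral

variable {π : X → ℝ} {P : Matrix X X ℝ}

/-- **Exercise 12.3: the eigenvalues of a lazy reversible chain are non-negative**, `0 ≤ λ_j` for
every `j` (positive `π`, `P(x,x) ≥ ½`). [cite: LevinPeres2017, Exercise 12.3] -/
theorem specVal_nonneg_of_lazy (hπ : ∀ x, 0 < π x) (hA : (symmMatrix π P).IsHermitian)
    (hP : IsRowStochastic P) (hlazy : ∀ x, 1 / 2 ≤ P x x) (j : X) : 0 ≤ specVal hA j := by
  -- the real eigenpair `(f_j, λ_j)` as a complex one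
  have hf0 : (fun x => (specFun hA j x : ℂ)) ≠ 0 := by
    intro h0
    have h1 := piInner_specFun hπ hA j j
    rw [if_pos rfl] at h1
    have hz : ∀ x, specFun hA j x = 0 := fun x => by
      have := congr_fun h0 x
      simp only [Pi.zero_apply] at this
      exact_mod_cast this
    unfold piInner at h1
    simp [hz] at h1
  have h := norm_two_mul_sub_one_le_one_of_lazy hP hlazy (sum_cast_mul_specFun hπ hA j) hf0
  have hreal : ‖(2 : ℂ) * (specVal hA j : ℂ) - 1‖ = |2 * specVal hA j - 1| := by
    rw [show (2 : ℂ) * (specVal hA j : ℂ) - 1 = ((2 * specVal hA j - 1 : ℝ) : ℂ) by push_cast; ring,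
      Complex.norm_real, Real.norm_eq_abs]
  rw [hreal] at h
  have := (abs_le.mp h).1
  linarith

/-- **Exercise 12.3 / §12.2: for a LAZY reversible irreducible chain `γ⋆ = γ`** — the absolute
spectral gap equals the spectral gap (all `λ_j ≥ 0`, so `λ⋆ = max_{λ_j ≠ 1}|λ_j| = max_{λ_j ≠ 1} λ_j =
λ₂`); positive `π`, `|X| ≥ 2`.  In particular `t_rel = 1/γ` for lazy chains.
[cite: LevinPeres2017, §12.2 ("Exercise 12.3 shows that if the chain is lazy, then `γ⋆ = γ`");
Exercise 12.3] -/
theorem LevinPeres2017_exercise_12_3 [Nontrivial X] (hπ : ∀ x, 0 < π x) (hπ1 : ∑ x, π x = 1)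
    (hP : IsRowStochastic P) (hDB : DetailedBalance π P) (hirr : IsIrreducible P)
    (hlazy : ∀ x, 1 / 2 ≤ P x x) : absSpectralGap P = spectralGap π P := by
  refine le_antisymm (absSpectralGap_le_spectralGap hπ hπ1 hP hDB hirr) ?_
  have hA := symmMatrix_isHermitian hπ hDB
  -- some `λ_j ≠ 1` exists: the gap eigenvalue `1 − Gap_R ∈ orthEigenvalues = {λ_j ≠ 1}`
  have hmem := (isGreatest_orthEigenvalues hπ hπ1 hP hDB).1
  rw [orthEigenvalues_eq hπ hπ1 hP hDB hirr hA] at hmem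
  obtain ⟨j₀, hj₀, -⟩ := hmem
  have hne : (univ.filter (fun j => specVal hA j ≠ 1)).Nonempty :=
    ⟨j₀, mem_filter.mpr ⟨mem_univ _, hj₀⟩⟩
  -- `λ⋆ = max |λ_j| = max λ_j = λ₂`
  unfold absSpectralGap spectralGap
  rw [lambdaStar_eq_sup hπ hA hne, secondEigenvalue_eq_sup hπ hπ1 hP hDB hirr hA hne]
  have : (univ.filter (fun j => specVal hA j ≠ 1)).sup' hne (fun j => |specVal hA j|) =
      (univ.filter (fun j => specVal hA j ≠ 1)).sup' hne (fun j => specVal hA j) :=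
    sup'_congr hne rfl fun j _ => abs_of_nonneg (specVal_nonneg_of_lazy hπ hA hP hlazy j)
  rw [this]

end Spectral

end Literature.Probability.MarkovChains
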